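import Mathlib

/-! # The Promislow (Hantzsche–Wendt) group as a decidable structure, and Gardam's unit

Reproduction of the explicit model of the Promislow group `P = ⟨a, b | b⁻¹a²b = a⁻², a⁻¹b²a = b⁻²⟩`
used in Gardam, *A counterexample to the unit conjecture for group rings*, Ann. of Math. 194 (2021),
§3.1: `P` is the extension of `ℤ³ = ⟨x, y, z⟩` (`x = a²`, `y = b²`, `z = (ab)²`) by `Q = ℤ/2 × ℤ/2`
with the section `{1, a, b, ab}`, the sign action of §3.1 and the cocycle table of §3.1.

Everything here is computable and kernel-decidable: elements are `⟨v, g⟩` with `v : ℤ³` and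
`g : Bool × Bool` (`(false,false) = 1`, `(true,false) = a`, `(false,true) = b`, `(true,true) = ab`),
meaning `x^{v₁} y^{v₂} z^{v₃} · σ(g)`; the product is `(v,g)(w,h) = (v + g·w + f(g,h), gh)`.
We prove this is a group (`Group PElt`), that `a, b` satisfy the defining relations of `P`, and we
verify Gardam's unit `α = p + qa + rb + sab` and its inverse in `𝔽₂[P]` by kernel `decide`
(group-ring elements over `𝔽₂` are lists of group elements with coefficients read mod 2).

Deliberately NOT here: the identification of this model with the abstract presented group
(Gardam §3.1 derives the model from the presentation), and anything about zero divisors —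
`K[P]` is a domain for every field `K` (Cliff 1980; Farkas–Snider 1976 in char 0), so no
zero-divisor certificate for `P` can exist; the structure is meant as a certificate checker
for group-ring identities in `P` (units, or products in a group without this property). -/

namespace Literature.Algebra.GroupRings

namespace Promislow

/-- Sign `(-1)^b`. [folklore] -/
def sgn (b : Bool) : ℤ := if b then -1 else 1

/-- An element `x^{v.1} y^{v.2.1} z^{v.2.2} · σ(g)` of `P`; `g = (s, t)` encodes `a^s b^t ∈ {1, a, b, ab}`.
[cite: Gardam2021, §3.1] -/
@[ext] structure PElt where
  x : ℤ
  y : ℤ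
  z : ℤ
  s : Bool
  t : Bool
  deriving DecidableEq, Repr

/-- The action of `Q` on `ℤ³` (Gardam §3.1: `xᵃ = x, yᵃ = y⁻¹, zᵃ = z⁻¹; xᵇ = x⁻¹, yᵇ = y, zᵇ = z⁻¹`). [cite: Gardam2021, §3.1] -/
def act (s t : Bool) (x y z : ℤ) : ℤ × ℤ × ℤ :=
  (sgn t * x, sgn s * y, sgn (xor s t) * z)

/-- The cocycle `f(g,h) = σ(g)σ(h)σ(gh)⁻¹ ∈ ℤ³` (exponents of `x, y, z`), Gardam §3.1 table:
rows `g`, columns `h`; e.g. `f(b, a) = x⁻¹ y z⁻¹`. [cite: Gardam2021, §3.1] -/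
def coc (s t s' t' : Bool) : ℤ × ℤ × ℤ :=
  match s, t, s', t' with
  | false, false, _, _ => (0, 0, 0)
  | _, _, false, false => (0, 0, 0)
  | true, false, true, false => (1, 0, 0)     -- f(a,a) = x
  | true, false, false, true => (0, 0, 0)     -- f(a,b) = 1
  | true, false, true, true => (1, 0, 0)      -- f(a,ab) = x
  | false, true, true, false => (-1, 1, -1)   -- f(b,a) = x⁻¹ y z⁻¹
  | false, true, false, true => (0, 1, 0)     -- f(b,b) = y
  | false, true, true, true => (-1, 0, -1)    -- f(b,ab) = x⁻¹ z⁻¹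
  | true, true, true, false => (0, -1, 1)     -- f(ab,a) = y⁻¹ z
  | true, true, false, true => (0, -1, 0)     -- f(ab,b) = y⁻¹
  | true, true, true, true => (0, 0, 1)       -- f(ab,ab) = z

/-- Multiplication `(v,g)(w,h) = (v + g·w + f(g,h), gh)`. [cite: Gardam2021, §3.1] -/
def mul (u v : PElt) : PElt :=
  let w := act u.s u.t v.x v.y v.z
  let f := coc u.s u.t v.s v.t
  ⟨u.x + w.1 + f.1, u.y + w.2.1 + f.2.1, u.z + w.2.2 + f.2.2, xor u.s v.s, xor u.t v.t⟩

/-- The identity. [folklore] -/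
def one : PElt := ⟨0, 0, 0, false, false⟩

/-- Inverse: `(v,g)⁻¹ = (g·(-v - f(g,g)), g)`. [folklore] -/
def inv (u : PElt) : PElt :=
  let f := coc u.s u.t u.s u.t
  let w := act u.s u.t (-u.x - f.1) (-u.y - f.2.1) (-u.z - f.2.2)
  ⟨w.1, w.2.1, w.2.2, u.s, u.t⟩

/-- Multiplication instance. [folklore] -/
instance : Mul PElt := ⟨mul⟩
/-- One instance. [folklore] -/
instance : One PElt := ⟨one⟩
/-- Inverse instance. [folklore] -/
instance : Inv PElt := ⟨inv⟩

/-- `sgn (s xor t) * u = sgn s * (sgn t * u)`. [folklore] -/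
theorem sgn_xor_mul (s t : Bool) (u : ℤ) : sgn (xor s t) * u = sgn s * (sgn t * u) := by
  cases s <;> cases t <;> simp [sgn]

/-- The cocycle identity `f(g,h) + f(gh,k) = g·f(h,k) + f(g,hk)`, checked over all 64 triples. [cite: Gardam2021, §3.1] -/
theorem coc_identity : ∀ s t s' t' s'' t'' : Bool,
    let l := coc s t s' t'
    let m := coc (xor s s') (xor t t') s'' t''
    let r := act s t (coc s' t' s'' t'').1 (coc s' t' s'' t'').2.1 (coc s' t' s'' t'').2.2
    let n := coc s t (xor s' s'') (xor t' t'')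
    l.1 + m.1 = r.1 + n.1 ∧ l.2.1 + m.2.1 = r.2.1 + n.2.1 ∧ l.2.2 + m.2.2 = r.2.2 + n.2.2 := by
  decide

/-- `f(1, h) = 0`. [folklore] -/
theorem coc_one_left (s t : Bool) : coc false false s t = (0, 0, 0) := by cases s <;> cases t <;> rfl
/-- `f(g, 1) = 0`. [folklore] -/
theorem coc_one_right (s t : Bool) : coc s t false false = (0, 0, 0) := by cases s <;> cases t <;> rfl

/-- Associativity of the twisted product (from the cocycle identity). [folklore] -/
theorem mul_assoc' (u v w : PElt) : mul (mul u v) w = mul u (mul v w) := by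
  obtain ⟨ux, uy, uz, us, ut⟩ := u
  obtain ⟨vx, vy, vz, vs, vt⟩ := v
  obtain ⟨wx, wy, wz, ws, wt⟩ := w
  have h := coc_identity us ut vs vt ws wt
  simp only at h
  obtain ⟨h1, h2, h3⟩ := h
  ext
  · simp only [mul, act, sgn_xor_mul] at *; linear_combination h1
  · simp only [mul, act, sgn_xor_mul] at *; linear_combination h2
  · simp only [mul, act, sgn_xor_mul] at *; linear_combination h3
  · simp [mul]
  · simp [mul]

/-- Left unit. [folklore] -/
theorem one_mul' (u : PElt) : mul one u = u := by
  obtain ⟨ux, uy, uz, us, ut⟩ := u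
  ext <;> simp [mul, one, act, sgn, coc_one_left]

/-- Right unit. [folklore] -/
theorem mul_one' (u : PElt) : mul u one = u := by
  obtain ⟨ux, uy, uz, us, ut⟩ := u
  ext <;> simp [mul, one, act, coc_one_right]

/-- Left inverse. [folklore] -/
theorem inv_mul_cancel' (u : PElt) : mul (inv u) u = one := by
  obtain ⟨ux, uy, uz, us, ut⟩ := u
  cases us <;> cases ut <;> (ext <;> simp [mul, one, inv, act, coc, sgn] <;> ring)

/-- `P` is a group. [cite: Gardam2021, §3.1] -/
instance : Group PElt where
  mul_assoc := mul_assoc'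
  one_mul := one_mul'
  mul_one := mul_one'
  inv_mul_cancel := inv_mul_cancel'

/-- The generator `a`. [cite: Gardam2021, §1] -/
def a : PElt := ⟨0, 0, 0, true, false⟩
/-- The generator `b`. [cite: Gardam2021, §1] -/
def b : PElt := ⟨0, 0, 0, false, true⟩
/-- `x = a²`. [cite: Gardam2021, §1] -/
def x : PElt := ⟨1, 0, 0, false, false⟩
/-- `y = b²`. [cite: Gardam2021, §1] -/
def y : PElt := ⟨0, 1, 0, false, false⟩
/-- `z = (ab)²`. [cite: Gardam2021, §1] -/
def z : PElt := ⟨0, 0, 1, false, false⟩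

/-- The defining relations of `P` hold in the model: `b⁻¹ a² b = a⁻²` and `a⁻¹ b² a = b⁻²`. [cite: Gardam2021, §1 and §3.1] -/
theorem relations : b⁻¹ * (a * a) * b = a⁻¹ * a⁻¹ ∧ a⁻¹ * (b * b) * a = b⁻¹ * b⁻¹ := by decide

/-- `x = a²`, `y = b²`, `z = (ab)²`. [cite: Gardam2021, §3.1] -/
theorem xyz : a * a = x ∧ b * b = y ∧ (a * b) * (a * b) = z := by decide

/-! ## Group-ring elements over `𝔽₂` as lists (coefficients mod 2) -/

/-- Coefficient (mod 2) of `g` in the formal sum represented by the list `l`. [folklore] -/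
def coeff (l : List PElt) (g : PElt) : Bool := (l.count g) % 2 == 1

/-- The list representing the product `l * m` (all pairwise products, multiplicities kept). [folklore] -/
def lmul (l m : List PElt) : List PElt := l.flatMap fun g => m.map fun h => g * h

/-- `l ≡ m` as `𝔽₂[P]`-elements: equal coefficients on every element occurring in either. [folklore] -/
def equiv (l m : List PElt) : Bool := (l ++ m).all fun g => coeff l g == coeff m g

/-- The Laurent monomial `x^i y^j z^k`. [folklore] -/
def mono (i j k : ℤ) : PElt := ⟨i, j, k, false, false⟩

/-- Gardam's `p = (1 + x)(1 + y)(1 + z⁻¹)`. [cite: Gardam2021, Thm A] -/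
def p : List PElt := [mono 0 0 0, mono 1 0 0, mono 0 1 0, mono 1 1 0, mono 0 0 (-1), mono 1 0 (-1), mono 0 1 (-1), mono 1 1 (-1)]
/-- Gardam's `q = x⁻¹y⁻¹ + x + y⁻¹z + z`. [cite: Gardam2021, Thm A] -/
def q : List PElt := [mono (-1) (-1) 0, mono 1 0 0, mono 0 (-1) 1, mono 0 0 1]
/-- Gardam's `r = 1 + x + y⁻¹z + xyz`. [cite: Gardam2021, Thm A] -/
def r : List PElt := [mono 0 0 0, mono 1 0 0, mono 0 (-1) 1, mono 1 1 1]
/-- Gardam's `s = 1 + (x + x⁻¹ + y + y⁻¹) z⁻¹`. [cite: Gardam2021, Thm A] -/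
def s : List PElt := [mono 0 0 0, mono 1 0 (-1), mono (-1) 0 (-1), mono 0 1 (-1), mono 0 (-1) (-1)]

/-- Right-multiplication of a list by a group element. [folklore] -/
def rmul (l : List PElt) (g : PElt) : List PElt := l.map (· * g)

/-- Gardam's unit `α = p + q a + r b + s ab`. [cite: Gardam2021, Thm A] -/
def alpha : List PElt := p ++ rmul q a ++ rmul r b ++ rmul s (a * b)

/-- The `a`-action on Laurent monomials (`x ↦ x, y ↦ y⁻¹, z ↦ z⁻¹`) applied to a list of monomials. [cite: Gardam2021, §3.1] -/
def actA (l : List PElt) : List PElt := l.map fun g => ⟨g.x, -g.y, -g.z, g.s, g.t⟩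

/-- Gardam's inverse `α' = x⁻¹pᵃ + x⁻¹ q a + y⁻¹ r b + z⁻¹ sᵃ ab` (Gardam 2021, proof of Lemma 1, signs vanish over `𝔽₂`). [cite: Gardam2021, Lemma 1] -/
def alpha' : List PElt :=
  rmul (actA p) (mono (-1) 0 0) ++ rmul (rmul q (mono (-1) 0 0)) a ++ rmul (rmul r (mono 0 (-1) 0)) b
    ++ rmul (rmul (actA s) (mono 0 0 (-1))) (a * b)

set_option maxRecDepth 100000 in
/-- `α' α = 1` in `𝔽₂[P]`, checked by kernel computation. [cite: Gardam2021, Thm A] -/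
theorem alpha'_mul_alpha : equiv (lmul alpha' alpha) [1] = true := by decide +kernel

set_option maxRecDepth 100000 in
/-- `α α' = 1` in `𝔽₂[P]`, checked by kernel computation. [cite: Gardam2021, Thm A] -/
theorem alpha_mul_alpha' : equiv (lmul alpha alpha') [1] = true := by decide +kernel

/-- `α` has 21 distinct terms with odd coefficient, so it is not of the form `g` (a trivial unit). [cite: Gardam2021, Thm A] -/
theorem alpha_support_card : (alpha.dedup.filter fun g => coeff alpha g).length = 21 := by decide

/-- Certificate predicate for a zero-divisor pair over `𝔽₂`: `l ≠ 0`, `m ≠ 0` (some element with odd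
coefficient) and `l * m ≡ 0`.  For a candidate pair `(l, m)` the check is `IsZeroDivisorPair l m = true := by decide +kernel`.
(No such pair exists in `𝔽₂[P]`: `K[P]` is a domain, Cliff 1980; the predicate is the checker a hit in
another group would be verified against.) [cite: Cliff1980, Thm] -/
def IsZeroDivisorPair (l m : List PElt) : Bool :=
  l.any (coeff l) && m.any (coeff m) && equiv (lmul l m) []

/-- Sanity: Gardam's unit is not a zero-divisor pair with its inverse (their product is `1`, not `0`). [cite: Gardam2021, Thm A] -/
theorem not_zd_alpha : IsZeroDivisorPair alpha alpha' = false := by decide +kernel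

end Promislow

end Literature.Algebra.GroupRings
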